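import Mathlib
import HarnessLib
import Summits.MatrixMultiplication.MatrixMultiplication.Theses.ProbeRankScaling

/-!
# Route ProbeRankScaling — support `ProbeRankBound` (`ρ · R_ρ(n) ≥ n³`)

We prove the ONE-LEG LAW for the `u`-leg (the `X`-variable leg) of a bilinear algorithm
`⟨k,m,n⟩ = ∑_l w_l ⊗ u_l ⊗ v_l` and deduce the route item `ProbeRankBound`.

Flattening (folklore; Bläser 2013 §5, Landsberg 2017 §2.1): index the ROWS by `(b₁, c)` and the
COLUMNS by `(b₂, a)`, where `a = (a₁,a₂) ∈ [k]×[n]` is the output index, `b = (b₁,b₂) ∈ [k]×[m]`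
the `X`-index and `c = (c₁,c₂) ∈ [m]×[n]` the `Y`-index. Since `⟨k,m,n⟩(a,b,c) = 1` iff
`a₁ = b₁ ∧ b₂ = c₁ ∧ a₂ = c₂`, every column `(b₂,a₁,a₂)` meets exactly one row `(a₁,(b₂,a₂))`:
the flattened tensor is a permutation matrix of size `k·m·n`. A triad `w ⊗ u ⊗ v` flattens to
the matrix `((b₁,c),(b₂,a)) ↦ U(b₁,b₂)·v(c)·w(a) = (L(v) · U · G(w))`, whose rank is at most
`rank U` (`U = (u(b₁,b₂))` the probe matrix). Rank subadditivity gives `k·m·n ≤ ∑_l rank U_l`;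
if every `rank U_l ≤ ρ` this is `≤ ρ·r`.
-/

namespace Summit.MatrixMultiplication.MatrixMultiplication.Theorems

open Literature.Computability.AlgebraicComplexity

section Generic

variable {K : Type*} [Field K]

/-- `rank (A + B) ≤ rank A + rank B` (folklore). -/
private theorem probeRankBound_rank_add_le {ι κ : Type*} [Fintype κ] (A B : Matrix ι κ K) :
    (A + B).rank ≤ A.rank + B.rank := by
  unfold Matrix.rank
  rw [Matrix.mulVecLin_add]
  exact (Submodule.finrank_mono (LinearMap.range_add_le _ _)).trans
    (Submodule.finrank_add_le_finrank_add_finrank _ _)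

/-- `rank (∑ᵢ Aᵢ) ≤ ∑ᵢ rank Aᵢ` (folklore). -/
private theorem probeRankBound_rank_sum_le {ι κ σ : Type*} [Fintype κ] (s : Finset σ)
    (A : σ → Matrix ι κ K) : (∑ i ∈ s, A i).rank ≤ ∑ i ∈ s, (A i).rank := by
  classical
  induction s using Finset.induction_on with
  | empty => simp
  | insert a s ha ih =>
    rw [Finset.sum_insert ha, Finset.sum_insert ha]
    exact (probeRankBound_rank_add_le _ _).trans (Nat.add_le_add_left ih _)

/-- The `u`-leg flattening `((b₁,c),(b₂,a)) ↦ U b₁ b₂ · v c · w a` of a triad factors as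
`L(v) * U * G(w)` and therefore has rank at most `rank U`. [folklore] -/
theorem rank_uLegFlattening_triad_le {β₁ β₂ γ α : Type*} [Fintype β₁] [Fintype β₂] [Fintype α]
    [DecidableEq β₁] [DecidableEq β₂] (U : Matrix β₁ β₂ K) (v : γ → K) (w : α → K) :
    (Matrix.of fun (p : β₁ × γ) (q : β₂ × α) => U p.1 q.1 * v p.2 * w q.2).rank ≤ U.rank := by
  have hfac : (Matrix.of fun (p : β₁ × γ) (q : β₂ × α) => U p.1 q.1 * v p.2 * w q.2) =
      (Matrix.of fun (p : β₁ × γ) (i : β₁) => if p.1 = i then v p.2 else 0) * U *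
        (Matrix.of fun (j : β₂) (q : β₂ × α) => if j = q.1 then w q.2 else 0) := by
    ext p q
    simp only [Matrix.mul_apply, Matrix.of_apply, ite_mul, zero_mul, mul_ite, mul_zero,
      Finset.sum_ite_eq, Finset.sum_ite_eq', Finset.mem_univ, if_true]
    ring
  rw [hfac]
  exact (Matrix.rank_mul_le_left _ _).trans (Matrix.rank_mul_le_right _ _)

/-- **One-leg law for the `u`-leg.** If `⟨k,m,n⟩ = ∑_l w_l ⊗ u_l ⊗ v_l` over a field, then
`k·m·n ≤ ∑_l rank U_l`, where `U_l = (u_l(b₁,b₂))` is the probe matrix of the `X`-leg: flatten rows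
`(b₁,c)` / columns `(b₂,a)`; `⟨k,m,n⟩` becomes a permutation matrix, each triad a matrix of rank
`≤ rank U_l`. [folklore; cf. Blaser2013 §5, Landsberg2017 §2.1] -/
theorem mul_le_sum_rank_uProbe (k m n r : ℕ) (w : Fin r → Fin k × Fin n → K)
    (u : Fin r → Fin k × Fin m → K) (v : Fin r → Fin m × Fin n → K)
    (h : matMulTensor K k m n = ∑ l, triad (w l) (u l) (v l)) :
    k * m * n ≤ ∑ l, (Matrix.of (Function.curry (u l))).rank := by
  classical
  -- the flattening bijection: column index `(b₂,(a₁,a₂))` ↦ row index `(a₁,(b₂,a₂))`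
  let σ : (Fin m × (Fin k × Fin n)) ≃ (Fin k × (Fin m × Fin n)) :=
    { toFun := fun q => (q.2.1, (q.1, q.2.2))
      invFun := fun p => (p.2.1, (p.1, p.2.2))
      left_inv := fun _ => rfl
      right_inv := fun _ => rfl }
  -- the flattened terms
  let N : Fin r → Matrix (Fin k × (Fin m × Fin n)) (Fin m × (Fin k × Fin n)) K := fun l =>
    Matrix.of fun p q => Matrix.of (Function.curry (u l)) p.1 q.1 * v l p.2 * w l q.2
  -- the flattened decomposition is a permutation matrix
  have hsum : ∑ l, N l =
      (1 : Matrix (Fin k × (Fin m × Fin n)) (Fin k × (Fin m × Fin n)) K).submatrix id σ := by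
    ext p q
    obtain ⟨b₁, c₁, c₂⟩ := p
    obtain ⟨b₂, a₁, a₂⟩ := q
    have happ := congrFun (congrFun (congrFun h (a₁, a₂)) (b₁, b₂)) (c₁, c₂)
    rw [Finset.sum_apply, Finset.sum_apply, Finset.sum_apply] at happ
    simp only [triad_apply, matMulTensor] at happ
    rw [Matrix.sum_apply]
    simp only [N, Matrix.of_apply, Function.curry_apply, Matrix.submatrix_apply, id,
      Matrix.one_apply, σ, Equiv.coe_fn_mk, Prod.mk.injEq]
    rw [show (∑ l, u l (b₁, b₂) * v l (c₁, c₂) * w l (a₁, a₂)) =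
        ∑ l, w l (a₁, a₂) * u l (b₁, b₂) * v l (c₁, c₂) from
      Finset.sum_congr rfl fun l _ => by ring, ← happ]
    by_cases H : a₁ = b₁ ∧ b₂ = c₁ ∧ a₂ = c₂
    · obtain ⟨rfl, rfl, rfl⟩ := H
      simp
    · have H' : ¬(b₁ = a₁ ∧ c₁ = b₂ ∧ c₂ = a₂) := fun ⟨h1, h2, h3⟩ =>
        H ⟨h1.symm, h2.symm, h3.symm⟩
      rw [if_neg H, if_neg H']
  have hrank : (∑ l, N l).rank = k * m * n := by
    rw [hsum, show ((1 : Matrix (Fin k × (Fin m × Fin n)) (Fin k × (Fin m × Fin n)) K).submatrix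
        id σ) = (1 : Matrix _ _ K).submatrix (Equiv.refl _) σ from rfl, Matrix.rank_submatrix,
      Matrix.rank_one]
    simp [Fintype.card_prod, Fintype.card_fin, mul_assoc]
  calc k * m * n = (∑ l, N l).rank := hrank.symm
    _ ≤ ∑ l, (N l).rank := probeRankBound_rank_sum_le _ _
    _ ≤ ∑ l, (Matrix.of (Function.curry (u l))).rank :=
        Finset.sum_le_sum fun l _ => rank_uLegFlattening_triad_le _ _ _

end Generic

/-- **`ProbeRankBound`** (route ProbeRankScaling, item stmt-MatrixMultiplication-7537): a
decomposition of `⟨n,n,n⟩` over `ℂ` with `r` terms whose `u`-probes all have matrix rank `≤ ρ`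
satisfies `n³ ≤ ρ·r` — the one-leg law `n³ ≤ ∑_l rank U_l` for the `u`-leg, and `∑_l rank U_l ≤ r·ρ`.
[folklore; cf. Blaser2013 §5, Landsberg2017 §2.1] -/
theorem probeRankBound_proof :
    Summit.MatrixMultiplication.MatrixMultiplication.Theses.ProbeRankScaling.ProbeRankBound := by
  unfold Summit.MatrixMultiplication.MatrixMultiplication.Theses.ProbeRankScaling.ProbeRankBound
  intro n ρ r w u v h hρ
  calc n ^ 3 = n * n * n := by ring
    _ ≤ ∑ l, (Matrix.of (Function.curry (u l))).rank := mul_le_sum_rank_uProbe n n n r w u v h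
    _ ≤ ∑ _l : Fin r, ρ := Finset.sum_le_sum fun l _ => hρ l
    _ = ρ * r := by simp [mul_comm]

end Summit.MatrixMultiplication.MatrixMultiplication.Theorems
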